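import Summits.HodgeConjecture.HodgeConjecture.Theorems.F0P3LettersTraceFactorisationS0      -- ★ p824116 TF ED. 2 frame + tokens of record (`trGp₀`, `tens₀`, `TestS₀`, `Unr₀`, `cptTriv₀`, `Cls`, `rep`, `Gp`, PH `IsProductHaar`)
import Summits.HodgeConjecture.HodgeConjecture.Theorems.F0P3TraceFactorisationKcInvariance     -- ★ (A-p12 (g16), D-cm): `cmCompactFactor_normal`, `tens₀_apply_of_mem_cmCompactFactor_mul'`
import Literature.NumberTheory.Automorphic.IntegratedOperatorFixedVectors                    -- ★ p825741 + ED. 2 (this seat, D-gen): `tsum_inner_integratedOperator_eq_zero_of_normal_left`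
import HarnessLib

/-!
# LINE «TraceFactorisation» PAY-DOWN — STUB (D) `stub_KcIdempotent` CLOSED: a class on which `Kc` acts non-trivially has `tr π′(f′_{S,∞} ⊗ f^S) = 0`

Cell `hodgecm-mathlib`, F0∕P3 «U3-mult», crux H413 (`stmt-HodgeConjecture-24833`); (O1) pay-down line `Cruxes/H413/Lines/F0_P3_TraceFactorisationPaydown.lean`
(drafter F0P3-p01 (g9), rf 8e7b407656bb5ffa; holder table F0P3-plan (g6) 14:31:56Z: (D) = A-p01 (g17), depth A-p12 (g16)).  PROOF lane
(`--supports stmt-HodgeConjecture-24833 --as helper`): theorems only, no `def`, no instance, no notation, no `sorry`.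

THE STUB (verbatim the registered text, over the Lines file's frame `(L H ι T hT μ ν)`):
`ν.IsMulLeftInvariant → ∀ S c fS fT, ¬ cptTriv₀ L ι H T hT μ c → trGp₀ (Gp L H) μ ν c (tens₀ S fS fT) = 0`
— fold in the Lines edition: `theorem stub_KcIdempotent … := F0P3TraceFactorisationKcIdempotent.trGp₀_tens₀_eq_zero_of_not_cptTriv₀ L H ι T hT μ ν`.

THE PROOF (RULING (V31) «the compact places are silenced to `e_{Kc}`»; [Rogawski1990 §14.6 p. 244]; [BorelJacquet1979 §4.6]; [Dixmier1977 §13.1.5]):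
* `f′ := tens₀ S fS fT = f′_{S,∞} ⊗ f^S` is LEFT `Kc`-invariant, `f′(k x) = f′(x)` for `k ∈ Kc = cmCompactFactor L ι H T hT` (★ `tens₀_apply_of_mem_cmCompactFactor_mul'`,
  A-p12 (g16): `f′_∞ = f_ι ⊗ e_{Kc}` by ★ `TestS₀.arch_archPart_mul`, and the finite factors do not see `k`);
* hence `R(k) ∘ R(f′) = R(λ_k f′) = R(f′)` for the right-regular representation `R` on `L²(U(H)(L⁺)∖U(H)(𝔸_{L⁺}), μ)` and any LEFT-invariant `ν`
  (★ `ContRepresentation.apply_comp_integratedOperator_eq_self_of_forall_mul_eq`), so `R(f′)` maps the closed invariant irreducible block `W := (rep c).space` into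
  `W ∩ L²^{Kc}` (★ `integratedOperator_apply_mem`);
* `Kc` is NORMAL in `U(H)(𝔸_{L⁺})` (★ `cmCompactFactor_normal`, A-p12 (g16): `Kc = {k | k_f = 1 ∧ pr_ι k_∞ = 1}`), so the `Kc`-fixed vectors of the irreducible `W` form a
  closed invariant subspace, which is `W` or `0` (★ `ContRepresentation.forall_fixed_or_forall_fixed_eq_zero_of_normal`); it is not `W` because `¬ cptTriv₀ c` says exactly
  that `Kc` does NOT fix `W` pointwise (★ `cptTriv₀_iff`); so it is `0`, `R(f′)|_W = 0`, and every diagonal term `⟪e_k, R(f′) e_k⟫` of ★ `trGp₀` (★ `trGp₀_def`) vanishes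
  (★ `ContRepresentation.tsum_inner_integratedOperator_eq_zero_of_normal_left`).
No unimodularity, no Haar measure on `Kc`, no averaging projector is used.

* §1 `trGp₀_tens₀_eq_zero_of_not_cptTriv₀` — THE STUB TEXT (head); `…_of_isHaarMeasure` (instance form); `…_of_isProductHaar` (under PH, the Lines file's premise).
HONEST LABEL: HC_CM is proved only modulo the 2 remaining named inputs (hLiu418, h413) — behind them the booked printed statements + the MOD package — until rung 0
closes; this file closes ONE in-house stub of a pay-down line and discharges no citation by itself.
-/

set_option autoImplicit false
-- the mandated namespace has the single-problem summit's repeated segment (`HodgeConjecture.HodgeConjecture`)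
set_option linter.dupNamespace false

noncomputable section

open NumberField IsDedekindDomain MeasureTheory
open Literature.NumberTheory.Rogawski1990 Literature.NumberTheory.GaloisRepresentations
open Literature.NumberTheory.Automorphic Literature.NumberTheory.Automorphic.UnitaryGroup
open Literature.NumberTheory.Automorphic.UnitaryGroup.CotangentForms
open scoped Matrix InnerProductSpace

namespace Summit.HodgeConjecture.HodgeConjecture.Cruxes.H413.F0P3TraceFactorisationKcIdempotent

open Summit.HodgeConjecture.HodgeConjecture.Cruxes.H413.F0P3InnerFormClassificationV6
open Summit.HodgeConjecture.HodgeConjecture.Cruxes.H413.F0P3ClassTokensOfRecord (Cls cl rep mult)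
open Summit.HodgeConjecture.HodgeConjecture.Cruxes.H413.F0P3CompactTrivOfRecord (cptTriv₀ cptTriv₀_iff)
open Summit.HodgeConjecture.HodgeConjecture.Cruxes.H413.F0P3TestFunctionsOfRecord (Unr₀)
open Summit.HodgeConjecture.HodgeConjecture.Cruxes.H413.F0P3SpectralSideOfRecord (trGp₀ trGp₀_def clsBasis)
open Summit.HodgeConjecture.HodgeConjecture.Cruxes.H413.F0P3SemilocalTestFunctionsOfRecord (TestS₀ tens₀)
open Summit.HodgeConjecture.HodgeConjecture.Cruxes.H413.F0P3LettersTraceFactorisation (IsProductHaar)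
open Summit.HodgeConjecture.HodgeConjecture.Cruxes.H413.F0P3TraceFactorisationKcInvariance (cmCompactFactor_normal tens₀_apply_of_mem_cmCompactFactor_mul')

variable (L : Type) [Field L] [NumberField L] [IsCMField L] (H : Matrix (Fin 3) (Fin 3) L) (ι : L →+* ℂ) (T : GL (Fin 3) ℂ)
  (hT : (T : Matrix (Fin 3) (Fin 3) ℂ)ᴴ * H.map ι * (T : Matrix (Fin 3) (Fin 3) ℂ) = Literature.Geometry.ComplexHyperbolic.BallModel.J)
  (μ : Measure (Gp L H).automorphicQuotient) [(Gp L H).IsAutomorphicMeasure μ]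
  [MeasurableSpace (Gp L H).Adelic] [BorelSpace (Gp L H).Adelic]
  (ν : Measure (Gp L H).Adelic) [IsFiniteMeasureOnCompacts ν]

/-! ## §1 The stub -/

/-- **STUB (D) `stub_KcIdempotent` of the «TraceFactorisation» pay-down line — THE REGISTERED TEXT.**  For a LEFT-invariant `ν` on `U(H)(𝔸_{L⁺})` and every
`S fS fT`: if the compact archimedean factor `Kc = cmCompactFactor L ι H T hT` does NOT act trivially on the class `c` (`¬ cptTriv₀ c`), then
`tr π′_c(f′_{S,∞} ⊗ f^S) = trGp₀ c (tens₀ S fS fT) = 0` — `f′_{S,∞} ⊗ f^S` is left `Kc`-invariant, so `R(k) ∘ R(f′) = R(f′)` and `R(f′)` lands in the `Kc`-fixed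
vectors of the irreducible block `(rep c).space`, which are `0` because `Kc ⊴ U(H)(𝔸)` and `Kc` does not fix the block pointwise.
[cite: Rogawski1990, §14.6 p. 244] [cite: BorelJacquet1979, §4.6] [cite: Dixmier1977, §13.1.5] -/
theorem trGp₀_tens₀_eq_zero_of_not_cptTriv₀ :
    ν.IsMulLeftInvariant →
      ∀ (S : Finset (Places L)) (c : Cls (Gp L H) μ) (fS : TestS₀ L H ι T hT S) (fT : Unr₀ L H S),
        ¬ cptTriv₀ L ι H T hT μ c → trGp₀ (Gp L H) μ ν c (tens₀ S fS fT) = 0 := by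
  intro hν S c fS fT hc
  -- `¬ cptTriv₀ c`: `Kc` does not fix the block `(rep c).space` pointwise
  have hnot : ¬ ∀ w ∈ (rep (Gp L H) μ c).space, ∀ k ∈ cmCompactFactor L ι H T hT, (Gp L H).rightRegular μ k w = w :=
    fun h => hc ((cptTriv₀_iff L ι H T hT μ c).2 fun k hk v => h v v.2 k hk)
  rw [trGp₀_def]
  exact ContRepresentation.tsum_inner_integratedOperator_eq_zero_of_normal_left ((Gp L H).isUnitary_rightRegular μ)
    ((Gp L H).isStronglyContinuous_rightRegular_holds μ) ν (cmCompactFactor L ι H T hT) (cmCompactFactor_normal L ι H T hT)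
    (rep (Gp L H) μ c).space (rep (Gp L H) μ c).irreducible hnot (tens₀ S fS fT)
    (fun k hk x => tens₀_apply_of_mem_cmCompactFactor_mul' fS fT hk x)
    (fun k => ((clsBasis (Gp L H) μ c k : (rep (Gp L H) μ c).space.toSubmodule) : (Gp L H).L2 μ)) fun k => (clsBasis (Gp L H) μ c k).2

/-- **Instance form**: for a Haar (indeed any left-invariant) `ν`, `¬ cptTriv₀ c → trGp₀ c (tens₀ S fS fT) = 0`. [cite: Rogawski1990, §14.6 p. 244]
[cite: BorelJacquet1979, §4.6] -/
theorem trGp₀_tens₀_eq_zero_of_not_cptTriv₀_of_isMulLeftInvariant [ν.IsMulLeftInvariant]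
    (S : Finset (Places L)) (c : Cls (Gp L H) μ) (fS : TestS₀ L H ι T hT S) (fT : Unr₀ L H S) (hc : ¬ cptTriv₀ L ι H T hT μ c) :
    trGp₀ (Gp L H) μ ν c (tens₀ S fS fT) = 0 :=
  trGp₀_tens₀_eq_zero_of_not_cptTriv₀ L H ι T hT μ ν ‹_› S c fS fT hc

/-- **Under PH** (★ `IsProductHaar`, the premise of TF ED. 2): `ν` is a Haar measure, hence left invariant, and the stub applies — the form consumed inside
`traceFactorisation_of_stubs` after `intro hPH`. [cite: Rogawski1990, §5.4 p. 72; §14.6 p. 244] [cite: BorelJacquet1979, §4.6] -/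
theorem trGp₀_tens₀_eq_zero_of_not_cptTriv₀_of_isProductHaar
    (νinf : @Measure (UnitaryGroup.arch (↥(maximalRealSubfield L)) L (IsCMField.complexConj L) 3 H) (borel _))
    (μv : ∀ v : Places L, @Measure ((cmDatum L 3 H).Local v) (borel _)) (hPH : IsProductHaar L H ν νinf μv)
    (S : Finset (Places L)) (c : Cls (Gp L H) μ) (fS : TestS₀ L H ι T hT S) (fT : Unr₀ L H S) (hc : ¬ cptTriv₀ L ι H T hT μ c) :
    trGp₀ (Gp L H) μ ν c (tens₀ S fS fT) = 0 :=
  haveI : ν.IsHaarMeasure := hPH.1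
  trGp₀_tens₀_eq_zero_of_not_cptTriv₀ L H ι T hT μ ν inferInstance S c fS fT hc

end Summit.HodgeConjecture.HodgeConjecture.Cruxes.H413.F0P3TraceFactorisationKcIdempotent

end
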